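import Mathlib.SetTheory.Cardinal.SchroederBernstein
import Literature.IUT.HodgeTheaters.PMBaseBridgePropsProofs7

/-!
# Proofs over [IUTchI] Prop 6.6 (iv): the gluing torsor — discharge of `GluingTorsor`

Mochizuki, *Inter-universal Teichmüller theory I*, §6, Proposition 6.6 (iv) p. 166, kurims manuscript
(May 2020). PROOF-ONLY companion (theorems, no definitions) to abc-iut-L5-t4's `PMBaseBridgeProps.lean`,
by the L5 discharge seat abc-iut-L5-t13.

**Prop 6.6 (iv) — PROVED** (`DThetaPMBridge.gluingTorsor`): the named statement `GluingTorsor B B'` for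
every `𝒟-Θ^±`-bridge `B` and `𝒟-Θ^{ell}`-bridge `B'` over any base kit — (1) some capsule-`+`-full
poly-isomorphism glues them into a `𝒟-Θ^{±ell}`-Hodge theater; (2) the gluings surject onto the
isomorphisms of `𝔽_l^±`-torsors `T ⥲ T'`; (3) over each such isomorphism the gluings form a `{±1}^𝕍`-torsor
(are in bijection with `{±1}^𝕍`): existence of an injective `{±1}^𝕍`-family (`…Proofs6`) and rigidity
(`…Proofs7`: any two differ by a constant twist), combined by Schröder–Bernstein.
Record only; [claim: Mochizuki2012, status: disputed]; nothing here takes a side on any disputed step.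
-/

namespace Literature.IUT.HodgeTheaters

open CategoryTheory

universe u

namespace PMBaseKit

variable {l : ℕ} {K : PMBaseKit.{u} l}

/-- **[IUTchI] Prop 6.6 (iv), third clause — PROVED**: over every isomorphism of `𝔽_l^±`-torsors between
the index sets, the gluing data that glue are in bijection with `{±1}^𝕍`.
[claim: Mochizuki2012, status: disputed] -/
theorem GluingData.nonempty_equiv_signs (B : K.DThetaPMBridge) (B' : K.DThetaEllBridge) (κ : B.T ≃ B'.T)
    (hκ : B.grpT.toTorsor.Compat B'.torT κ) :
    Nonempty ({G : GluingData B B' // G.Glues ∧ G.indexEquiv = κ} ≃ (K.V → ℤˣ)) := by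
  classical
  -- the fibre over `κ`, presented by the constituent poly-isomorphisms alone
  let S' := {P : ∀ t, Set ((B.capsule t).Iso (B'.capsule (κ t))) //
    ∃ h : ∀ t, DStrip.IsPlusFullPolyIso (P t), (GluingData.mk κ P h).Glues}
  let e : S' → {G : GluingData B B' // G.Glues ∧ G.indexEquiv = κ} :=
    fun P => ⟨⟨κ, P.1, P.2.fst⟩, P.2.snd, rfl⟩
  have he : Function.Bijective e := by
    constructor
    · rintro ⟨P, hP⟩ ⟨P', hP'⟩ h
      have h1 := congrArg (fun G : {G : GluingData B B' // G.Glues ∧ G.indexEquiv = κ} => G.1) h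
      simp only [e, GluingData.mk.injEq, heq_eq_eq, true_and] at h1
      exact Subtype.ext h1
    · rintro ⟨⟨κG, P, hP⟩, hG, hκG⟩
      dsimp only at hκG
      subst hκG
      exact ⟨⟨P, hP, hG⟩, rfl⟩
  let E := Equiv.ofBijective e he
  -- an injective `{±1}^𝕍`-family (existence direction)
  obtain ⟨Φ, hΦ⟩ := GluingData.exists_injective_family B B' κ hκ
  let Φ' : (K.V → ℤˣ) ↪ S' := ⟨fun σ => E.symm (Φ σ), E.symm.injective.comp hΦ⟩
  -- rigidity: the twist relative to a base point is an injective invariant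
  let P₀ : S' := Φ' 1
  have hΨ : ∀ P : S', ∃ σ : K.V → ℤˣ, ∀ t,
      P.1 t = DStrip.polyComp (P₀.1 t) ((B'.capsule (κ t)).signedPolyAut σ) :=
    fun P => GluingData.exists_relTwist κ P₀.1 P.1 P₀.2.fst P.2.fst P₀.2.snd P.2.snd
  choose Ψ hΨ using hΨ
  have hΨinj : Function.Injective Ψ := by
    intro P P' h
    apply Subtype.ext
    funext t
    rw [hΨ P t, hΨ P' t, h]
  obtain ⟨F⟩ := Function.Embedding.antisymm ⟨Ψ, hΨinj⟩ Φ'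
  exact ⟨E.symm.trans F⟩

namespace DThetaPMBridge

/-- **[IUTchI] Prop 6.6 (iv) — PROVED**: the named statement `GluingTorsor`. "Given a `𝒟-Θ^±`-bridge and a
`𝒟-Θ^{ell}`-bridge, the set of capsule-`+`-full poly-isomorphisms between the respective capsules of
`𝒟`-prime-strips which allow one to glue the given bridges together to form a `𝒟-Θ^{±ell}`-Hodge theater
forms a torsor over `𝔽_l^{⋊±} × ({±1}^𝕍)`; the first factor corresponds to the induced isomorphisms of
`𝔽_l^±`-torsors between the index sets" (p. 166). [claim: Mochizuki2012, status: disputed] -/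
theorem gluingTorsor (B : K.DThetaPMBridge) (B' : K.DThetaEllBridge) : GluingTorsor B B' := fun _ =>
  ⟨GluingData.exists_glues B B', fun κ hκ => GluingData.exists_glues_of_compat B B' κ hκ,
    fun κ hκ => GluingData.nonempty_equiv_signs B B' κ hκ⟩

/-- `GluingTorsor` holds for all parameters — `_holds` alias of `gluingTorsor` above under the fact's exact name
(appended 2026-08-28, D-0026 bookkeeping: the proof term is the existing theorem of this file; no statement,
definition or attribute is edited; no new named fact; the ledger's debt table listed the fact
unproved). [claim: Mochizuki2012, status: disputed] -/
theorem _root_.Literature.IUT.HodgeTheaters.PMBaseKit.GluingTorsor_holds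
    (B : K.DThetaPMBridge) (B' : K.DThetaEllBridge) :
    GluingTorsor B B' :=
  _root_.Literature.IUT.HodgeTheaters.PMBaseKit.DThetaPMBridge.gluingTorsor B B'

end DThetaPMBridge

end PMBaseKit

end Literature.IUT.HodgeTheaters
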